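import Literature.NumberTheory.EllipticCurves.ComplexMultiplicationDeuring0Proofs
import Literature.NumberTheory.GaloisRepresentations.CubicJacobiSumPrimary
import HarnessLib

/-!
# Frobenius traces of the `j = 0` curves for the symmetric square:
# `a_p = 0` for `p ≡ 2 (mod 3)` and `a_p² = χ_𝔭(Δ)ϖ² + \overline{χ_𝔭(Δ)ϖ²} + 2p` for `p ≡ 1 (mod 3)`

Topic `NumberTheory/EllipticCurves`; namespace `Literature.NumberTheory.EllipticCurves`. Sibling proof
file of `ComplexMultiplicationDeuring0Proofs` (Deuring's `a_p = π + π̄` for `j = 0`, which "stopped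
before the evaluation `J(χ_π, χ_π) = π` of the Jacobi sum"); theorems only, no definition, no named
fact (D-0026). Filed in support of the named fact `murty_petersson_newform_lower_bound`
(`NewformPeterssonSize`): the CM side of Murty's / Hoffstein–Lockhart's bound is reduced in the tree to
the single family `j = 0` (`NewformPeterssonSizeCMReductionProofs`), whose symmetric squares factor
through a Grössencharacter of `ℚ(ω)` of frequency `2`; this file supplies the arithmetic half of that
factorisation, prime by prime, in the exact analogue of `ComplexMultiplicationDeuring1728Square`
(`j = 1728`, `ℚ(i)`).

For a globally minimal `W/ℚ` with `j(W) = 0` (`c₄ = 0`, `c₆² = −1728 Δ`) and a prime `p ∤ 6Δ`: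

* `exists_frobeniusTrace_eq_neg_sum_of_j_eq_zero` — the reduction is `𝔽_p`-isomorphic to
  `y² = x³ + B` with `B ≠ 0`, **`864 B = −c₆`**, and `a_p(W) = −Σ_x ρ(x³ + B)` (`ρ` the quadratic
  character; Ireland–Rosen Ch. 18 §3, proof of Thm. 4);
* `frobeniusTrace_eq_zero_of_j_eq_zero_of_mod_three_eq_two` — **`a_p = 0` for `p ≡ 2 (mod 3)`**
  (`x ↦ x³` permutes `𝔽_p`, `pow_three_bijective_of_mod_three_eq_two`);
* `frobeniusTrace_sq_of_j_eq_zero` — for a prime `𝔭` of `K = ℚ(ω)` over `p` of degree one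
  (`p ≡ 1 (mod 3)`), `ϖ` its generator `≡ 1 (mod 3)` and an embedding `σ : K → ℂ`:
  **`a_p² = σ(χ_𝔭(Δ) ϖ²) + \overline{σ(χ_𝔭(Δ) ϖ²)} + 2p`**, `χ_𝔭` the cubic residue character
  (`CubicResidueSymbol`), `Δ` the minimal discriminant. Proof: Ireland–Rosen's count
  `Σ_x ρ(x³ + B) = cJ(χ, ρ) + \overline{cJ(χ, ρ)}`, `c = ρ(B)χ(−B)` (`sum_quadraticChar_cube_add`) for the
  character `χ = σ ∘ χ_𝔭` transported to the residue field; `J(χ, ρ) = χ(4)J(χ, χ)` and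
  `J(χ_𝔭, χ_𝔭) = −ϖ` (`CubicJacobiSumPrimary`); `|cJ|² = p`; so `a_p = ρ(B)(z + z̄)` with
  `z = χ(−4B)σ(ϖ)`, `a_p² = z² + z̄² + 2p`, and `z² = χ(16B²)σ(ϖ)² = χ(Δ)σ(ϖ)²` since
  `16 B² = Δ·(−3)⁻³` in `𝔽_p`. The sextic symbol of Ireland–Rosen's Thm. 4 is not needed for the
  square: only the cubic residue character of `Δ` (equivalently of `c₆²`, `4B`, …) appears — the
  finite part of the frequency-`2` Grössencharacter `𝔭 ↦ χ_𝔭(Δ) ϖ²/p` of the symmetric square.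

## References

* K. Ireland, M. Rosen, *A Classical Introduction to Modern Number Theory*, 2nd ed., GTM 84 (1990),
  Ch. 18 §3 Thm. 4 and its proof (PDF pp. 298–299); Ch. 8 §3; Ch. 9 §4 Lemma 1.
  [cite: IrelandRosen1990, Ch. 18 §3 Theorem 4]

## Mathlib / tree search

Tree: `reductionModPrime`, `isElliptic_reductionModPrime`, `reductionPointCount_eq_natCard_point`,
`frobeniusTrace`, `integralModelInt`, `map_integralModelInt`, `minimalDiscriminantInt`,
`WeierstrassCurve.j_eq_zero_iff` (`GlobalMinimalModel`, `ComplexMultiplicationDeuringReduction`);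
`HasseElementary.natCard_point_eq/numY_eq/eval_cubic`; `sum_quadraticChar_cube_add`, `jacobiSum_mul_conj`,
`conj_apply_eq_sq`, `apply_pow_three_eq_one` (`ComplexMultiplicationDeuring0Proofs`);
`cubicResidueChar`, `cubicResidueSymbol_spec`, `three_dvd_residueCard_sub_one`,
`residueCard_sub_one_div_three_ne_zero` (`CubicResidueSymbol`); `cubicJacobiSum_eq`,
`charP_quotient_of_natCast_mem`, `three_not_mem_of_natCast_mem` (`CubicReciprocityRationalPrime`);
`jacobiSum_quadraticChar_eq_mul_jacobiSum_self`, `cubicJacobiSum_eq_neg_of_span_eq`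
(`CubicJacobiSumPrimary`). Mathlib: `WeierstrassCurve.toShortNF`, `c₄_of_isShortNF`, `c₆_of_isShortNF`,
`variableChange_c₆`, `c_relation`, `ZMod.ringEquivOfPrime`, `quadraticChar_dichotomy`,
`quadraticChar_one_iff_isSquare`, `quadraticChar_neg_one_iff_not_isSquare`, `quadraticChar_sum_zero`,
`jacobiSum_ringHomComp`, `orderOf_eq_prime`, `Function.Bijective.sum_comp`.
-/

noncomputable section

open scoped Classical ComplexConjugate

open WeierstrassCurve NumberField IsDedekindDomain Finset

namespace Literature.NumberTheory.EllipticCurves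

open Literature.NumberTheory.GaloisRepresentations

/-! ### The reduction of a `j = 0` curve is `y² = x³ + B` with `864 B = −c₆` -/

/-- For a globally minimal `W/ℚ` with `j(W) = 0` and a prime `p ≥ 5` of good reduction: the short
Weierstrass model `C • Ẽ` (`C = toShortNF`) of the reduction `Ẽ` of `W` modulo `p` has `a₄ = 0`,
`a₆ = B ≠ 0` with **`864 B = −c₆(W)`** (`c₄ = 0`, `toShortNF` has `u = 1` so `c₆` is unchanged, and
`c₆ = −864 a₆` in short form), and `a_p(W) = −Σ_x ρ(x³ + B)` for the quadratic character `ρ` of `𝔽_p`.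
[cite: IrelandRosen1990, Ch. 18 §3, proof of Thm. 4 (PDF p. 298)] -/
theorem exists_frobeniusTrace_eq_neg_sum_of_j_eq_zero (W : WeierstrassCurve ℚ) [W.IsElliptic]
    [W.IsGloballyMinimal] (hj : W.j = 0) {p : ℕ} [Fact p.Prime] (h2 : (2 : ZMod p) ≠ 0)
    (h3 : (3 : ZMod p) ≠ 0) (hΔ : ¬ (p : ℤ) ∣ minimalDiscriminantInt W) :
    ∃ B : ZMod p, B ≠ 0 ∧ (864 : ZMod p) * B = -(((integralModelInt W).c₆ : ℤ) : ZMod p) ∧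
      (W.frobeniusTrace p : ℤ) = -∑ x : ZMod p, (quadraticChar (ZMod p) (x ^ 3 + B) : ℤ) := by
  haveI hE : (reductionModPrime W p).IsElliptic := isElliptic_reductionModPrime W hΔ
  have hc4 : (reductionModPrime W p).c₄ = 0 := by
    have h0 : W.c₄ = 0 := W.j_eq_zero_iff.mp hj
    have hc : ((integralModelInt W).c₄ : ℚ) = W.c₄ := by
      have h := (integralModelInt W).map_c₄ (Int.castRingHom ℚ)
      rw [map_integralModelInt, eq_intCast] at h
      exact h.symm
    have hint : (integralModelInt W).c₄ = 0 := by exact_mod_cast hc.trans h0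
    show ((integralModelInt W).map (Int.castRingHom (ZMod p))).c₄ = 0
    rw [map_c₄, hint, map_zero]
  haveI : Invertible (2 : ZMod p) := invertibleOfNonzero h2
  haveI : Invertible (3 : ZMod p) := invertibleOfNonzero h3
  set C := (reductionModPrime W p).toShortNF with hC
  have hCu : C.u = 1 := by
    simp [hC, toShortNF, toCharNeTwoNF, VariableChange.mul_def]
  have ha4 : (C • reductionModPrime W p).a₄ = 0 := by
    have h := (C • reductionModPrime W p).c₄_of_isShortNF
    rw [variableChange_c₄, hc4, mul_zero] at h
    have h48 : (-48 : ZMod p) ≠ 0 := by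
      rw [show (-48 : ZMod p) = -(2 ^ 4 * 3) by norm_num]
      exact neg_ne_zero.mpr (mul_ne_zero (pow_ne_zero _ h2) h3)
    exact (mul_eq_zero.mp h.symm).resolve_left h48
  set B := (C • reductionModPrime W p).a₆ with hB
  have hB0 : B ≠ 0 := by
    intro h0
    have hΔ0 : (C • reductionModPrime W p).Δ = 0 := by
      rw [(C • reductionModPrime W p).Δ_of_isShortNF, ha4, ← hB, h0]; ring
    exact (C • reductionModPrime W p).Δ'.ne_zero (by rw [coe_Δ']; exact hΔ0)
  -- `864 B = -c₆`
  have hc6 : (864 : ZMod p) * B = -(((integralModelInt W).c₆ : ℤ) : ZMod p) := by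
    have h := (C • reductionModPrime W p).c₆_of_isShortNF
    rw [variableChange_c₆, hCu, inv_one, Units.val_one, one_pow, one_mul, ← hB] at h
    have hc₆W : (reductionModPrime W p).c₆ = (((integralModelInt W).c₆ : ℤ) : ZMod p) := by
      show ((integralModelInt W).map (Int.castRingHom (ZMod p))).c₆ = _
      rw [map_c₆, eq_intCast]
    rw [← hc₆W, h]; ring
  -- `#Ẽ(𝔽_p) = 1 + Σ_x (ρ(x³ + B) + 1)`, so `a_p = -Σ_x ρ(x³ + B)`
  have hpF : ringChar (ZMod p) ≠ 2 := by
    intro h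
    apply h2
    have := ringChar.Nat.cast_ringChar (R := ZMod p)
    rw [h] at this
    exact_mod_cast this
  have hcount : (reductionPointCount W p : ℤ) =
      1 + ∑ x : ZMod p, ((quadraticChar (ZMod p) (x ^ 3 + B) : ℤ) + 1) := by
    rw [reductionPointCount_eq_natCard_point,
      Nat.card_congr (VariableChange.pointEquiv (reductionModPrime W p) C).toEquiv,
      Literature.NumberTheory.EllipticCurves.HasseElementary.natCard_point_eq]
    push_cast
    congr 1
    refine sum_congr rfl fun x _ => ?_
    rw [Literature.NumberTheory.EllipticCurves.HasseElementary.numY_eq _ hpF,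
      Literature.NumberTheory.EllipticCurves.HasseElementary.eval_cubic, ha4, ← hB, zero_mul,
      add_zero]
    congr!
  refine ⟨B, hB0, hc6, ?_⟩
  rw [frobeniusTrace, hcount, sum_add_distrib, sum_const, card_univ, ZMod.card p]
  ring

/-- `2 ≠ 0` and `3 ≠ 0` in `𝔽_p` for a prime `p ≠ 2, 3`. [folklore] -/
theorem two_three_ne_zero_zmod {p : ℕ} (hp : p.Prime) (h2 : p ≠ 2) (h3 : p ≠ 3) :
    (2 : ZMod p) ≠ 0 ∧ (3 : ZMod p) ≠ 0 := by
  constructor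
  · intro h0
    have h0' : ((2 : ℕ) : ZMod p) = 0 := by exact_mod_cast h0
    rw [ZMod.natCast_eq_zero_iff] at h0'
    exact h2 ((Nat.prime_dvd_prime_iff_eq hp Nat.prime_two).mp h0')
  · intro h0
    have h0' : ((3 : ℕ) : ZMod p) = 0 := by exact_mod_cast h0
    rw [ZMod.natCast_eq_zero_iff] at h0'
    exact h3 ((Nat.prime_dvd_prime_iff_eq hp Nat.prime_three).mp h0')

/-! ### `p ≡ 2 (mod 3)`: `a_p = 0` -/

/-- `x ↦ x³` is a bijection of `𝔽_p` for `p ≡ 2 (mod 3)` (no element of `𝔽_pˣ` has order `3`).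
[folklore] -/
theorem pow_three_bijective_of_mod_three_eq_two {p : ℕ} [Fact p.Prime] (hp3 : p % 3 = 2) :
    Function.Bijective fun x : ZMod p ↦ x ^ 3 := by
  have hp : p.Prime := Fact.out
  refine (Finite.injective_iff_bijective).mp fun x y hxy ↦ ?_
  by_cases hx : x = 0
  · subst hx
    rw [zero_pow three_ne_zero] at hxy
    exact (pow_eq_zero_iff three_ne_zero).mp hxy.symm |>.symm
  · have hy : y ≠ 0 := by
      rintro rfl
      rw [zero_pow three_ne_zero, pow_eq_zero_iff three_ne_zero] at hxy
      exact hx hxy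
    -- `u = y/x` has `u³ = 1`, and `3 ∤ p - 1`, so `u = 1`
    set u : (ZMod p)ˣ := Units.mk0 y hy / Units.mk0 x hx with hu
    have hu3 : u ^ 3 = 1 := by
      ext
      rw [hu, div_pow, Units.val_div_eq_div_val, Units.val_pow_eq_pow_val, Units.val_pow_eq_pow_val,
        Units.val_mk0, Units.val_mk0, ← hxy, div_self (pow_ne_zero _ hx), Units.val_one]
    have hord : orderOf u ∣ 3 := orderOf_dvd_of_pow_eq_one hu3
    have hcard : orderOf u ∣ p - 1 := by
      have h := orderOf_dvd_card (G := (ZMod p)ˣ) (x := u)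
      rwa [ZMod.card_units p] at h
    have h1 : orderOf u = 1 := by
      rcases (Nat.dvd_prime Nat.prime_three).mp hord with h | h
      · exact h
      · exfalso
        rw [h] at hcard
        have := hp.two_le
        omega
    rw [orderOf_eq_one_iff] at h1
    have := congrArg (fun v : (ZMod p)ˣ ↦ (v : ZMod p) * x) h1
    simp only [hu, Units.val_div_eq_div_val, Units.val_mk0, Units.val_one, one_mul,
      div_mul_cancel₀ _ hx] at this
    exact this.symm

/-- **`a_p(W) = 0` at a good prime `p ≡ 2 (mod 3)`, `p ≠ 2`, of a globally minimal `W/ℚ` with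
`j(W) = 0`** (supersingular reduction: `x ↦ x³ + B` permutes `𝔽_p`, so `Σ_x ρ(x³ + B) = Σ_u ρ(u) = 0`;
Ireland–Rosen Ch. 18 §3 Thm. 4, the case `p ≡ 2 (mod 3)`: `N_p = p + 1`).
[cite: IrelandRosen1990, Ch. 18 §3, Theorem 4] -/
theorem frobeniusTrace_eq_zero_of_j_eq_zero_of_mod_three_eq_two (W : WeierstrassCurve ℚ) [W.IsElliptic]
    [W.IsGloballyMinimal] (hj : W.j = 0) {p : ℕ} (hp : p.Prime) (hp3 : p % 3 = 2) (h2 : p ≠ 2)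
    (hΔ : ¬ (p : ℤ) ∣ minimalDiscriminantInt W) : W.frobeniusTrace p = 0 := by
  haveI : Fact p.Prime := ⟨hp⟩
  have h3 : p ≠ 3 := by rintro rfl; norm_num at hp3
  obtain ⟨h2', h3'⟩ := two_three_ne_zero_zmod hp h2 h3
  obtain ⟨B, -, -, hft⟩ := exists_frobeniusTrace_eq_neg_sum_of_j_eq_zero W hj h2' h3' hΔ
  have hpF : ringChar (ZMod p) ≠ 2 := by rw [ZMod.ringChar_zmod_n]; exact h2
  have hbij : Function.Bijective fun x : ZMod p ↦ x ^ 3 + B :=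
    (Equiv.addRight B).bijective.comp (pow_three_bijective_of_mod_three_eq_two hp3)
  have hsum : ∑ x : ZMod p, (quadraticChar (ZMod p) (x ^ 3 + B) : ℤ) =
      ∑ u : ZMod p, (quadraticChar (ZMod p) u : ℤ) :=
    hbij.sum_comp (fun u ↦ (quadraticChar (ZMod p) u : ℤ))
  rw [hft, hsum, quadraticChar_sum_zero hpF, neg_zero]

/-! ### The cubic residue character of `ℤ[ω]` transported to a residue field with `p` elements -/

section Split

variable {K : Type*} [Field K] [NumberField K]
variable {ζ : 𝓞 K} (hζ : IsPrimitiveRoot ζ 3)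


/-- The quadratic character is invariant under a ring isomorphism. [folklore] -/
theorem quadraticChar_ringEquiv_apply {F F' : Type*} [Field F] [Fintype F] [DecidableEq F] [Field F']
    [Fintype F'] [DecidableEq F'] (e : F' ≃+* F) (x : F') :
    quadraticChar F (e x) = quadraticChar F' x := by
  by_cases hx : x = 0
  · simp [hx]
  have hex : e x ≠ 0 := (map_ne_zero e).mpr hx
  have hiff : IsSquare (e x) ↔ IsSquare x := by
    constructor
    · rintro ⟨r, hr⟩
      exact ⟨e.symm r, by apply e.injective; simp [hr]⟩
    · rintro ⟨r, hr⟩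
      exact ⟨e r, by rw [hr, map_mul]⟩
  rcases quadraticChar_dichotomy hx with h | h
  · rw [h, quadraticChar_one_iff_isSquare hex, hiff]
    exact (quadraticChar_one_iff_isSquare hx).mp h
  · rw [h, quadraticChar_neg_one_iff_not_isSquare, hiff]
    exact quadraticChar_neg_one_iff_not_isSquare.mp h

variable [IsCyclotomicExtension {3} ℚ K]

include hζ in
/-- **`a_p² = χ_𝔭(Δ) ϖ² + \overline{χ_𝔭(Δ) ϖ²} + 2p` at a good prime `p ≡ 1 (mod 3)` of a globally
minimal `W/ℚ` with `j(W) = 0`** (Ireland–Rosen Ch. 18 §3 Thm. 4, squared and made independent of the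
sextic symbol): here `𝔭` is a prime of `K = ℚ(ω)` above `p` of degree one, `ϖ` its generator
`≡ 1 (mod 3)`, `χ_𝔭` the cubic residue character, `Δ` the minimal discriminant, and both sides are
read in `ℂ` through an embedding `σ`. Proof: `a_p = −Σ_x ρ(x³ + B)` on the short model `y² = x³ + B`
of the reduction (`864 B = −c₆`), `Σ_x ρ(x³ + B) = cJ(χ, ρ) + \overline{cJ(χ, ρ)}` with
`c = ρ(B)χ(−B)` (`sum_quadraticChar_cube_add`) for the transported character `χ = σ ∘ χ_𝔭`,
`J(χ, ρ) = χ(4) J(χ, χ)` and `J(χ_𝔭, χ_𝔭) = −ϖ` (`CubicJacobiSumPrimary`), `|cJ|² = p`; hence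
`a_p = ρ(B)(z + z̄)`, `z = χ(−4B) σ(ϖ)`, `a_p² = z² + z̄² + 2p` and
`z² = χ(16B²) σ(ϖ)² = χ(Δ) σ(ϖ)²` because `16 B² = Δ · (−3)⁻³` (`c₄ = 0`, `c₆² = −1728 Δ`).
[cite: IrelandRosen1990, Ch. 18 §3, Theorem 4 (proof, PDF pp. 298–299)] -/
theorem frobeniusTrace_sq_of_j_eq_zero (W : WeierstrassCurve ℚ) [W.IsElliptic] [W.IsGloballyMinimal]
    (hj : W.j = 0) {p : ℕ} (hp : p.Prime) (h2 : p ≠ 2) (h3 : p ≠ 3)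
    (hΔ : ¬ (p : ℤ) ∣ minimalDiscriminantInt W) (σ : K →+* ℂ)
    {𝔭 : HeightOneSpectrum (𝓞 K)} (hp𝔭 : (p : 𝓞 K) ∈ 𝔭.asIdeal) (hdeg : 𝔭.residueCard = p)
    {ϖ : 𝓞 K} (hϖ : Ideal.span {ϖ} = 𝔭.asIdeal) (hϖ1 : ϖ - 1 ∈ Ideal.span {(3 : 𝓞 K)}) :
    ((W.frobeniusTrace p : ℤ) : ℂ) ^ 2 =
      σ (cubicResidueSymbol 𝔭 (Ideal.Quotient.mk 𝔭.asIdeal (minimalDiscriminantInt W : 𝓞 K)) : K)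
          * σ (ϖ : K) ^ 2 +
        conj (σ (cubicResidueSymbol 𝔭 (Ideal.Quotient.mk 𝔭.asIdeal (minimalDiscriminantInt W : 𝓞 K)) : K)
          * σ (ϖ : K) ^ 2) + 2 * p := by
  haveI : Fact p.Prime := ⟨hp⟩
  obtain ⟨h2', h3'⟩ := two_three_ne_zero_zmod hp h2 h3
  obtain ⟨B, hB0, hc6, hft⟩ := exists_frobeniusTrace_eq_neg_sum_of_j_eq_zero W hj h2' h3' hΔ
  -- the residue field `F` of `𝔭` has `p` elements
  letI := Ideal.Quotient.field 𝔭.asIdeal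
  letI := Fintype.ofFinite (𝓞 K ⧸ 𝔭.asIdeal)
  have hcardF : Fintype.card (𝓞 K ⧸ 𝔭.asIdeal) = p := by
    rw [← Nat.card_eq_fintype_card, ← HeightOneSpectrum.residueCard_eq_card_quotient, hdeg]
  haveI hchar : CharP (𝓞 K ⧸ 𝔭.asIdeal) p := charP_quotient_of_natCast_mem (K := K) hp𝔭
  have hpF : ringChar (𝓞 K ⧸ 𝔭.asIdeal) ≠ 2 := by rw [ringChar.eq _ p]; exact h2
  have h3𝔭 : (3 : 𝓞 K) ∉ 𝔭.asIdeal := by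
    refine three_not_mem_of_natCast_mem hp𝔭 ?_
    rw [Nat.coprime_comm, Nat.Prime.coprime_iff_not_dvd Nat.prime_three]
    intro h
    exact h3 ((Nat.prime_dvd_prime_iff_eq Nat.prime_three hp).mp h).symm
  -- the isomorphism `e : 𝔽_p ≃ F` and the transported sum
  set e : ZMod p ≃+* 𝓞 K ⧸ 𝔭.asIdeal := ZMod.ringEquivOfPrime (𝓞 K ⧸ 𝔭.asIdeal) hp hcardF with he
  set B' : 𝓞 K ⧸ 𝔭.asIdeal := e B with hB'
  have hB'0 : B' ≠ 0 := (map_ne_zero e).mpr hB0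
  set ρ : MulChar (𝓞 K ⧸ 𝔭.asIdeal) ℂ :=
    (quadraticChar (𝓞 K ⧸ 𝔭.asIdeal)).ringHomComp (Int.castRingHom ℂ) with hρ
  have hρapp : ∀ y, ρ y = ((quadraticChar (𝓞 K ⧸ 𝔭.asIdeal) y : ℤ) : ℂ) := fun y ↦ by
    rw [hρ, MulChar.ringHomComp_apply, eq_intCast]
  have hsum : ((W.frobeniusTrace p : ℤ) : ℂ) = -∑ y : 𝓞 K ⧸ 𝔭.asIdeal, ρ (y ^ 3 + B') := by
    rw [hft, Int.cast_neg, Int.cast_sum]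
    congr 1
    refine Fintype.sum_equiv e.toEquiv _ _ fun x ↦ ?_
    rw [hρapp, RingEquiv.toEquiv_eq_coe, EquivLike.coe_coe, hB', ← map_pow, ← map_add,
      quadraticChar_ringEquiv_apply]
  -- the cubic character `χ = σ ∘ χ_𝔭` on `F`, of order `3`
  set τ : 𝓞 K →+* ℂ := σ.comp (algebraMap (𝓞 K) K) with hτ
  have hτapp : ∀ x : 𝓞 K, τ x = σ (x : K) := fun x ↦ rfl
  have hτinj : Function.Injective τ :=
    σ.injective.comp (FaithfulSMul.algebraMap_injective (𝓞 K) K)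
  set χ₀ := cubicResidueChar hζ 𝔭 h3𝔭 with hχ₀def
  set χ : MulChar (𝓞 K ⧸ 𝔭.asIdeal) ℂ := χ₀.ringHomComp τ with hχdef
  have hχapp : ∀ a, χ a = τ (cubicResidueSymbol 𝔭 a) := fun a ↦ rfl
  have hχ3 : χ ^ 3 = 1 := by
    rw [hχdef, MulChar.ringHomComp_pow, hχ₀def, cubicResidueChar_pow_three hζ h3𝔭,
      MulChar.ringHomComp_one]
  have hχne : χ ≠ 1 := by
    intro h1
    obtain ⟨g, hg⟩ := IsCyclic.exists_generator (α := (𝓞 K ⧸ 𝔭.asIdeal)ˣ)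
    have hg3 : cubicResidueSymbol 𝔭 (g : 𝓞 K ⧸ 𝔭.asIdeal) ≠ 1 := by
      intro hg1
      have hspec := (cubicResidueSymbol_spec hζ h3𝔭 (Units.ne_zero g)).2
      rw [hg1, map_one] at hspec
      have hord : orderOf g = Fintype.card (𝓞 K ⧸ 𝔭.asIdeal) - 1 := by
        rw [orderOf_eq_card_of_forall_mem_zpowers hg, Nat.card_eq_fintype_card, Fintype.card_units]
      have hcardF' : Fintype.card (𝓞 K ⧸ 𝔭.asIdeal) = 𝔭.residueCard := by
        rw [HeightOneSpectrum.residueCard_eq_card_quotient, Nat.card_eq_fintype_card]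
      have hdvd := orderOf_dvd_of_pow_eq_one (x := g) (n := (𝔭.residueCard - 1) / 3)
        (Units.ext (by rw [Units.val_pow_eq_pow_val, Units.val_one, ← hspec]))
      rw [hord, hcardF'] at hdvd
      have hpos := residueCard_sub_one_div_three_ne_zero hζ h3𝔭 (𝔭 := 𝔭)
      have h3dvd := three_dvd_residueCard_sub_one hζ h3𝔭 (𝔭 := 𝔭)
      have hle := Nat.le_of_dvd (Nat.pos_of_ne_zero hpos) hdvd
      omega
    apply hg3
    apply hτinj
    have h := congrArg (fun χ' : MulChar (𝓞 K ⧸ 𝔭.asIdeal) ℂ ↦ χ' (g : 𝓞 K ⧸ 𝔭.asIdeal)) h1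
    simp only [hχapp, MulChar.one_apply_coe] at h
    rw [h, map_one]
  have hordχ : orderOf χ = 3 := orderOf_eq_prime hχ3 hχne
  -- Ireland–Rosen's count and the two Jacobi-sum identities
  have key := sum_quadraticChar_cube_add hpF hordχ hB'0
  rw [← hρ] at key
  have hJρ : jacobiSum χ ρ = χ 4 * jacobiSum χ χ :=
    jacobiSum_quadraticChar_eq_mul_jacobiSum_self hpF hχne
  have hJJ : jacobiSum χ χ = -τ ϖ := by
    rw [hχdef, jacobiSum_ringHomComp, hχ₀def, ← cubicJacobiSum_eq hζ 𝔭 h3𝔭,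
      cubicJacobiSum_eq_neg_of_span_eq hζ 𝔭 h3𝔭 hϖ hϖ1, map_neg]
  have hnorm := jacobiSum_mul_conj hpF hordχ
  rw [← hρ, hcardF] at hnorm
  -- `z = c J(χ, ρ)` with `z z̄ = p`
  set z : ℂ := ρ B' * χ (-B') * jacobiSum χ ρ with hzdef
  have hzz : z * conj z = p := by
    have hρB : ρ B' * conj (ρ B') = 1 := by
      rw [hρapp]
      rcases quadraticChar_dichotomy hB'0 with h | h <;> simp [h]
    have hχB : χ (-B') * conj (χ (-B')) = 1 := by
      rw [conj_apply_eq_sq hordχ, ← pow_succ', apply_pow_three_eq_one hordχ (neg_ne_zero.mpr hB'0)]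
    calc z * conj z = (ρ B' * conj (ρ B')) * (χ (-B') * conj (χ (-B'))) *
          (jacobiSum χ ρ * conj (jacobiSum χ ρ)) := by rw [hzdef, map_mul, map_mul]; ring
      _ = p := by rw [hρB, hχB, hnorm, one_mul, one_mul]
  -- `z² = χ(16 B²) σ(ϖ)²`
  have hz2 : z ^ 2 = χ ((-4 * B') ^ 2) * τ ϖ ^ 2 := by
    have hρB2 : ρ B' ^ 2 = 1 := by
      rw [hρapp]
      rcases quadraticChar_dichotomy hB'0 with h | h <;> simp [h]
    rw [hzdef, hJρ, hJJ, map_pow, show (-4 : 𝓞 K ⧸ 𝔭.asIdeal) * B' = -B' * 4 by ring, map_mul]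
    linear_combination (χ (-B') * χ 4 * τ ϖ) ^ 2 * hρB2
  -- `16 B² = Δ (−3)⁻³` in `𝔽_p`, so `χ(16 B²) = χ(Δ)`
  have hc4int : (integralModelInt W).c₄ = 0 := by
    have h0 : W.c₄ = 0 := W.j_eq_zero_iff.mp hj
    have hc : ((integralModelInt W).c₄ : ℚ) = W.c₄ := by
      have h := (integralModelInt W).map_c₄ (Int.castRingHom ℚ)
      rw [map_integralModelInt, eq_intCast] at h
      exact h.symm
    exact_mod_cast hc.trans h0
  have hrel : ((integralModelInt W).c₆ : ℤ) ^ 2 = -1728 * minimalDiscriminantInt W := by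
    have h := (integralModelInt W).c_relation
    rw [hc4int] at h
    have : (integralModelInt W).Δ = minimalDiscriminantInt W := rfl
    rw [this] at h
    linear_combination h
  have h16 : (-4 * B') ^ 2 = e ((minimalDiscriminantInt W : ℤ) : ZMod p) * (e ((-3 : ZMod p)⁻¹)) ^ 3 := by
    set u : ZMod p := (-3 : ZMod p)⁻¹ with hu
    have h3inv : (-3 : ZMod p) * u = 1 := mul_inv_cancel₀ (neg_ne_zero.mpr h3')
    have hsq : ((864 : ZMod p) * B) ^ 2 = -1728 * ((minimalDiscriminantInt W : ℤ) : ZMod p) := by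
      have hrelp : (((integralModelInt W).c₆ : ℤ) : ZMod p) ^ 2 =
          -1728 * ((minimalDiscriminantInt W : ℤ) : ZMod p) := by
        have h := congrArg (Int.cast : ℤ → ZMod p) hrel
        push_cast at h
        exact h
      rw [hc6, neg_sq, hrelp]
    have h1728 : (1728 : ZMod p) ≠ 0 := by
      rw [show (1728 : ZMod p) = 2 ^ 6 * 3 ^ 3 by norm_num]
      exact mul_ne_zero (pow_ne_zero _ h2') (pow_ne_zero _ h3')
    have hT : (1728 : ZMod p) *
        ((-4 * B) ^ 2 - ((minimalDiscriminantInt W : ℤ) : ZMod p) * u ^ 3) = 0 := by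
      linear_combination (-u ^ 3) * hsq +
        (-27648 * B ^ 2 * (((-3) * u) ^ 2 + (-3) * u + 1)) * h3inv
    have hBrel : (-4 * B) ^ 2 = ((minimalDiscriminantInt W : ℤ) : ZMod p) * u ^ 3 :=
      sub_eq_zero.mp ((mul_eq_zero.mp hT).resolve_left h1728)
    have h := congrArg e hBrel
    rw [map_pow, map_mul, map_neg, map_mul, map_pow, map_ofNat] at h
    rw [hB', h]
  have hχ16 : χ ((-4 * B') ^ 2) =
      τ (cubicResidueSymbol 𝔭 (Ideal.Quotient.mk 𝔭.asIdeal (minimalDiscriminantInt W : 𝓞 K))) := by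
    have hu : e ((-3 : ZMod p)⁻¹) ≠ 0 := (map_ne_zero e).mpr (inv_ne_zero (neg_ne_zero.mpr h3'))
    have hcube : χ (e ((-3 : ZMod p)⁻¹)) ^ 3 = 1 := apply_pow_three_eq_one hordχ hu
    rw [h16, map_mul, map_pow, hcube, mul_one, hχapp]
    congr 2
    rw [map_intCast, map_intCast]
  -- assembly: `a_p = -(z + z̄)`, `a_p² = z² + z̄² + 2 z z̄`
  have ha : ((W.frobeniusTrace p : ℤ) : ℂ) = -(z + conj z) := by rw [hsum, key]
  have hz2' : z ^ 2 = τ (cubicResidueSymbol 𝔭 (Ideal.Quotient.mk 𝔭.asIdeal (minimalDiscriminantInt W : 𝓞 K)))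
      * τ ϖ ^ 2 := by rw [hz2, hχ16]
  have hconj2 : conj z ^ 2 = conj (z ^ 2) := (map_pow _ _ _).symm
  calc ((W.frobeniusTrace p : ℤ) : ℂ) ^ 2 = z ^ 2 + conj z ^ 2 + 2 * (z * conj z) := by rw [ha]; ring
    _ = _ := by rw [hconj2, hz2', hzz, hτapp, hτapp, map_mul, map_pow]

end Split

end Literature.NumberTheory.EllipticCurves

end
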